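import Mathlib.Analysis.SpecificLimits.Basic
import Mathlib.Analysis.Normed.Ring.InfiniteSum
import Mathlib.Algebra.Group.Int.Even
import Mathlib.Data.Int.ModEq
import Mathlib.Data.Fin.VecNotation
import Mathlib.Algebra.BigOperators.Fin
import HarnessLib

/-!
# Theta series of the cubic lattices `ℤ³ ⊃ D₃` (fcc) and `2ℤ³ ∪ (2ℤ³ + 𝟙)` (bcc)

Topic `Algebra/EuclideanLattices`. Elementary, fully proved bookkeeping for Gaussian lattice sums
`∑_{v ∈ Λ} q^{‖v‖²}` (`0 ≤ q < 1`) over the two cubic root lattices of rank `3`, written, as in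
Conway–Sloane (SPLAG, Ch. 4), through the one-dimensional series
`θ₃(q⁴) = ∑_{n ∈ ℤ} q^{(2n)²}` and `θ₂(q⁴) = ∑_{n ∈ ℤ} q^{(2n+1)²}` (Ch. 4 §4.1 (8), (9)); below,
`θ_c(q) := ∑_{n ∈ ℤ} q^{(2n+c)²}` for `c ∈ {0, 1}` (spelled out as a `tsum`, no new definition).

## Results

* `tsum_prod_coset_eq` — for a parity pattern `c ∈ {0,1}³`, the Gaussian sum over the coset
  `2ℤ³ + c` factorises: `∑_{w ∈ ℤ³} ∏ᵢ q^{(2wᵢ+cᵢ)²} = ∏ᵢ θ_{cᵢ}(q)`.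
* `tsum_indicator_fccInt` — **Conway–Sloane Ch. 4 (66)**, `Θ_fcc = θ₃(4z)³ + 3θ₃(4z)θ₂(4z)²`:
  `∑_{v ∈ D₃ ∖ 0} q^{‖v‖²} = θ₀³ + 3 θ₀ θ₁² - 1`, `D₃ = {v ∈ ℤ³ : v₁ + v₂ + v₃ even}`.
* `tsum_indicator_bccInt` — **Conway–Sloane Ch. 4 (84)**, `Θ_bcc = θ₂(4z)³ + θ₃(4z)³` for
  "the points `(x,y,z)` where `x, y` and `z` are all even or all odd":
  `∑_{v ∈ bcc ∖ 0} q^{‖v‖²} = θ₀³ + θ₁³ - 1`.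
* `theta_zero_eq`, `theta_one_eq` — `θ₀ = 1 + 2∑_{n ≥ 0} q^{4(n+1)²}`,
  `θ₁ = ∑_{n ≥ 0} q^{(2n+3)²} + q + ∑_{n ≥ 0} q^{(2n+1)²}`; and two-sided numerical envelopes
  `theta_zero_ge/le`, `theta_one_ge/le` (truncation + geometric tail), monotone in `q`, which is
  what interval arithmetic on such sums needs.

## Purpose

Used by `Literature/Barriers/AtomisticToContinuum/NoUniversallyOptimalLattice3DProofs.lean` to
prove Cohn–Kumar's remark that at unit density fcc has larger `e^{-|x|²}`-energy than bcc
(a `9 · 10⁻⁵` gap, so every step here is an identity or a certified inequality).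

## References

* J. H. Conway, N. J. A. Sloane, *Sphere Packings, Lattices and Groups*, 3rd ed., Springer 1999,
  Ch. 4: §4.1 eqs. (8)–(9) (`θ₂`, `θ₃`), §6.3 eq. (66) (fcc), §6.7 eq. (84) (bcc)
  (`lit read book:conway1999-sphere-packings-lattices-groups`, PDF pp. 210, 220, 222).
-/

noncomputable section

namespace Literature.Algebra.EuclideanLattices

variable {q l h : ℝ}

/-! ## One-dimensional series -/

/-- `∑_{k ∈ ℤ} q^{|k|}` converges for `0 ≤ q < 1`. [folklore] -/
theorem summable_pow_natAbs (hq0 : 0 ≤ q) (hq1 : q < 1) :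
    Summable fun k : ℤ => q ^ k.natAbs := by
  rw [summable_int_iff_summable_nat_and_neg]
  simp only [Int.natAbs_neg, Int.natAbs_natCast]
  exact ⟨summable_geometric_of_lt_one hq0 hq1, summable_geometric_of_lt_one hq0 hq1⟩

/-- `∑_{k ∈ ℤ} q^{k²}` converges for `0 ≤ q < 1`. [folklore] -/
theorem summable_pow_natAbs_sq (hq0 : 0 ≤ q) (hq1 : q < 1) :
    Summable fun k : ℤ => q ^ (k.natAbs ^ 2) :=
  (summable_pow_natAbs hq0 hq1).of_nonneg_of_le (fun _ => pow_nonneg hq0 _)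
    (fun _ => pow_le_pow_of_le_one hq0 hq1.le (Nat.le_self_pow two_ne_zero _))

/-- The terms of `θ_c(q) = ∑_{n ∈ ℤ} q^{(2n+c)²}` are summable for `0 ≤ q < 1`. [folklore] -/
theorem summable_theta_term (hq0 : 0 ≤ q) (hq1 : q < 1) (c : ℤ) :
    Summable fun n : ℤ => q ^ ((2 * n + c).natAbs ^ 2) :=
  (summable_pow_natAbs_sq hq0 hq1).comp_injective
    (i := fun n : ℤ => 2 * n + c) (fun a b hab => by simpa using hab)

/-- `θ_c(q) ≥ 0`. [folklore] -/
theorem theta_nonneg (hq0 : 0 ≤ q) (c : ℤ) : 0 ≤ ∑' n : ℤ, q ^ ((2 * n + c).natAbs ^ 2) :=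
  tsum_nonneg fun _ => pow_nonneg hq0 _

/-- `q^{e(n)}` is summable over `ℕ` when `e(n) ≥ n` and `0 ≤ q < 1`. [folklore] -/
theorem summable_pow_of_le (hq0 : 0 ≤ q) (hq1 : q < 1) {e : ℕ → ℕ} (he : ∀ n, n ≤ e n) :
    Summable fun n => q ^ e n :=
  (summable_geometric_of_lt_one hq0 hq1).of_nonneg_of_le (fun _ => pow_nonneg hq0 _)
    fun n => pow_le_pow_of_le_one hq0 hq1.le (he n)

/-- A series dominated by `K ρⁿ`, `0 ≤ ρ < 1`, converges and is at most `K/(1-ρ)`. [folklore] -/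
theorem tsum_le_div_of_le_geometric {a : ℕ → ℝ} {K ρ : ℝ} (hρ0 : 0 ≤ ρ) (hρ1 : ρ < 1)
    (h0 : ∀ n, 0 ≤ a n) (h : ∀ n, a n ≤ K * ρ ^ n) :
    Summable a ∧ ∑' n, a n ≤ K / (1 - ρ) := by
  have hg : Summable fun n => K * ρ ^ n := (summable_geometric_of_lt_one hρ0 hρ1).mul_left K
  have ha : Summable a := hg.of_nonneg_of_le h0 h
  refine ⟨ha, ?_⟩
  calc ∑' n, a n ≤ ∑' n, K * ρ ^ n := ha.tsum_le_tsum h hg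
    _ = K / (1 - ρ) := by rw [tsum_mul_left, tsum_geometric_of_lt_one hρ0 hρ1, div_eq_mul_inv]

/-- Head plus geometric tail: if `a(n+N) ≤ K ρⁿ` then `∑ a ≤ ∑_{n<N} a(n) + K/(1-ρ)`. [folklore] -/
theorem tsum_le_sum_add_div {a : ℕ → ℝ} (ha : Summable a) (h0 : ∀ n, 0 ≤ a n) (N : ℕ)
    {K ρ : ℝ} (hρ0 : 0 ≤ ρ) (hρ1 : ρ < 1) (h : ∀ n, a (n + N) ≤ K * ρ ^ n) :
    ∑' n, a n ≤ ∑ n ∈ Finset.range N, a n + K / (1 - ρ) := by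
  rw [← ha.sum_add_tsum_nat_add N]
  gcongr
  exact (tsum_le_div_of_le_geometric hρ0 hρ1 (fun n => h0 _) h).2

/-- `θ₀(q) = θ₃(q⁴) = 1 + 2 ∑_{n ≥ 0} q^{4(n+1)²}`.
[cite: ConwaySloane1999, Ch. 4 §4.1 eq. (9)] -/
theorem theta_zero_eq (hq0 : 0 ≤ q) (hq1 : q < 1) :
    ∑' n : ℤ, q ^ ((2 * n + 0).natAbs ^ 2) = 1 + 2 * ∑' n : ℕ, q ^ (4 * (n + 1) ^ 2) := by
  have hs := summable_theta_term hq0 hq1 0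
  have h1 : ∀ n : ℕ, q ^ ((2 * ((n : ℤ) + 1) + 0).natAbs ^ 2) = q ^ (4 * (n + 1) ^ 2) := by
    intro n
    rw [show (2 * ((n : ℤ) + 1) + 0).natAbs = 2 * (n + 1) by omega]; ring
  have h2 : ∀ n : ℕ, q ^ ((2 * (-((n : ℤ) + 1)) + 0).natAbs ^ 2) = q ^ (4 * (n + 1) ^ 2) := by
    intro n
    rw [show (2 * (-((n : ℤ) + 1)) + 0).natAbs = 2 * (n + 1) by omega]; ring
  have hA : Summable fun n : ℕ => q ^ ((2 * ((n : ℤ) + 1) + 0).natAbs ^ 2) :=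
    hs.comp_injective (i := fun n : ℕ => (n : ℤ) + 1) (fun a b hab => by simpa using hab)
  have hB : Summable fun n : ℕ => q ^ ((2 * (-((n : ℤ) + 1)) + 0).natAbs ^ 2) :=
    hs.comp_injective (i := fun n : ℕ => -((n : ℤ) + 1)) (fun a b hab => by simpa using hab)
  rw [tsum_of_add_one_of_neg_add_one (f := fun n : ℤ => q ^ ((2 * n + 0).natAbs ^ 2)) hA hB]
  simp only [h1, h2]
  simp; ring

/-- `θ₁(q) = θ₂(q⁴) = ∑_{n ≥ 0} q^{(2n+3)²} + q + ∑_{n ≥ 0} q^{(2n+1)²}` (split at `n = 0`).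
[cite: ConwaySloane1999, Ch. 4 §4.1 eq. (8)] -/
theorem theta_one_eq (hq0 : 0 ≤ q) (hq1 : q < 1) :
    ∑' n : ℤ, q ^ ((2 * n + 1).natAbs ^ 2) =
      (∑' n : ℕ, q ^ ((2 * n + 3) ^ 2)) + q + ∑' n : ℕ, q ^ ((2 * n + 1) ^ 2) := by
  have hs := summable_theta_term hq0 hq1 1
  have h1 : ∀ n : ℕ, q ^ ((2 * ((n : ℤ) + 1) + 1).natAbs ^ 2) = q ^ ((2 * n + 3) ^ 2) := by
    intro n
    rw [show (2 * ((n : ℤ) + 1) + 1).natAbs = 2 * n + 3 by omega]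
  have h2 : ∀ n : ℕ, q ^ ((2 * (-((n : ℤ) + 1)) + 1).natAbs ^ 2) = q ^ ((2 * n + 1) ^ 2) := by
    intro n
    rw [show (2 * (-((n : ℤ) + 1)) + 1).natAbs = 2 * n + 1 by omega]
  have hA : Summable fun n : ℕ => q ^ ((2 * ((n : ℤ) + 1) + 1).natAbs ^ 2) :=
    hs.comp_injective (i := fun n : ℕ => (n : ℤ) + 1) (fun a b hab => by simpa using hab)
  have hB : Summable fun n : ℕ => q ^ ((2 * (-((n : ℤ) + 1)) + 1).natAbs ^ 2) :=
    hs.comp_injective (i := fun n : ℕ => -((n : ℤ) + 1)) (fun a b hab => by simpa using hab)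
  rw [tsum_of_add_one_of_neg_add_one (f := fun n : ℤ => q ^ ((2 * n + 1).natAbs ^ 2)) hA hB]
  simp only [h1, h2]
  simp

/-- Lower envelope `θ₀(q) ≥ 1 + 2(l⁴ + l¹⁶)` for `0 ≤ l ≤ q < 1`. [folklore] -/
theorem theta_zero_ge (hl0 : 0 ≤ l) (hlq : l ≤ q) (hq1 : q < 1) :
    1 + 2 * (l ^ 4 + l ^ 16) ≤ ∑' n : ℤ, q ^ ((2 * n + 0).natAbs ^ 2) := by
  have hq0 : 0 ≤ q := hl0.trans hlq
  have hA : Summable fun n : ℕ => q ^ (4 * (n + 1) ^ 2) :=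
    summable_pow_of_le hq0 hq1 fun n => by nlinarith
  rw [theta_zero_eq hq0 hq1]
  have h1 := hA.sum_le_tsum (Finset.range 2) (fun i _ => pow_nonneg hq0 _)
  simp only [Finset.sum_range_succ, Finset.sum_range_zero] at h1
  norm_num at h1
  have e1 : l ^ 4 ≤ q ^ 4 := pow_le_pow_left₀ hl0 hlq 4
  have e2 : l ^ 16 ≤ q ^ 16 := pow_le_pow_left₀ hl0 hlq 16
  linarith

/-- Lower envelope `θ₁(q) ≥ 2(l + l⁹ + l²⁵)` for `0 ≤ l ≤ q < 1`. [folklore] -/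
theorem theta_one_ge (hl0 : 0 ≤ l) (hlq : l ≤ q) (hq1 : q < 1) :
    2 * (l + l ^ 9 + l ^ 25) ≤ ∑' n : ℤ, q ^ ((2 * n + 1).natAbs ^ 2) := by
  have hq0 : 0 ≤ q := hl0.trans hlq
  have hB : Summable fun n : ℕ => q ^ ((2 * n + 1) ^ 2) :=
    summable_pow_of_le hq0 hq1 fun n => by nlinarith
  have hB' : Summable fun n : ℕ => q ^ ((2 * n + 3) ^ 2) :=
    summable_pow_of_le hq0 hq1 fun n => by nlinarith
  rw [theta_one_eq hq0 hq1]
  have h1 := hB.sum_le_tsum (Finset.range 3) (fun i _ => pow_nonneg hq0 _)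
  have h2 := hB'.sum_le_tsum (Finset.range 2) (fun i _ => pow_nonneg hq0 _)
  simp only [Finset.sum_range_succ, Finset.sum_range_zero] at h1 h2
  norm_num at h1 h2
  have e1 : l ≤ q := hlq
  have e2 : l ^ 9 ≤ q ^ 9 := pow_le_pow_left₀ hl0 hlq 9
  have e3 : l ^ 25 ≤ q ^ 25 := pow_le_pow_left₀ hl0 hlq 25
  linarith

/-- Upper envelope `θ₀(q) ≤ 1 + 2(h⁴ + h¹⁶ + h³⁶/(1 - h²⁴))` for `0 ≤ q ≤ h < 1`
(terms `n ≥ 2` of `∑ q^{4(n+1)²}` are dominated by `q³⁶ (q²⁴)ⁿ`). [folklore] -/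
theorem theta_zero_le (hq0 : 0 ≤ q) (hqh : q ≤ h) (hh1 : h < 1) :
    ∑' n : ℤ, q ^ ((2 * n + 0).natAbs ^ 2) ≤ 1 + 2 * (h ^ 4 + h ^ 16 + h ^ 36 / (1 - h ^ 24)) := by
  have hq1 : q < 1 := hqh.trans_lt hh1
  have hh0 : 0 ≤ h := hq0.trans hqh
  have hA : Summable fun n : ℕ => q ^ (4 * (n + 1) ^ 2) :=
    summable_pow_of_le hq0 hq1 fun n => by nlinarith
  rw [theta_zero_eq hq0 hq1]
  have ht := tsum_le_sum_add_div hA (fun n => pow_nonneg hq0 _) 2 (K := h ^ 36) (ρ := h ^ 24)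
    (pow_nonneg hh0 _) (pow_lt_one₀ hh0 hh1 (by norm_num)) (fun n => by
      rw [show 4 * (n + 2 + 1) ^ 2 = 36 + 24 * n + 4 * n ^ 2 by ring, pow_add, pow_add, pow_mul]
      calc q ^ 36 * (q ^ 24) ^ n * q ^ (4 * n ^ 2) ≤ q ^ 36 * (q ^ 24) ^ n :=
            mul_le_of_le_one_right (by positivity) (pow_le_one₀ hq0 hq1.le)
        _ ≤ h ^ 36 * (h ^ 24) ^ n := by gcongr)
  simp only [Finset.sum_range_succ, Finset.sum_range_zero] at ht
  norm_num at ht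
  have e1 : q ^ 4 ≤ h ^ 4 := pow_le_pow_left₀ hq0 hqh 4
  have e2 : q ^ 16 ≤ h ^ 16 := pow_le_pow_left₀ hq0 hqh 16
  linarith

/-- Upper envelope `θ₁(q) ≤ 2(h + h⁹ + h²⁵ + h⁴⁹/(1 - h²⁸))` for `0 ≤ q ≤ h < 1`
(terms `q^{(2n+7)²}`, `n ≥ 0`, are dominated by `q⁴⁹ (q²⁸)ⁿ`). [folklore] -/
theorem theta_one_le (hq0 : 0 ≤ q) (hqh : q ≤ h) (hh1 : h < 1) :
    ∑' n : ℤ, q ^ ((2 * n + 1).natAbs ^ 2) ≤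
      2 * (h + h ^ 9 + h ^ 25 + h ^ 49 / (1 - h ^ 28)) := by
  have hq1 : q < 1 := hqh.trans_lt hh1
  have hh0 : 0 ≤ h := hq0.trans hqh
  have hB : Summable fun n : ℕ => q ^ ((2 * n + 1) ^ 2) :=
    summable_pow_of_le hq0 hq1 fun n => by nlinarith
  have hB' : Summable fun n : ℕ => q ^ ((2 * n + 3) ^ 2) :=
    summable_pow_of_le hq0 hq1 fun n => by nlinarith
  have tail : ∀ n : ℕ, q ^ ((2 * n + 7) ^ 2) ≤ h ^ 49 * (h ^ 28) ^ n := fun n => by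
    rw [show (2 * n + 7) ^ 2 = 49 + 28 * n + 4 * n ^ 2 by ring, pow_add, pow_add, pow_mul]
    calc q ^ 49 * (q ^ 28) ^ n * q ^ (4 * n ^ 2) ≤ q ^ 49 * (q ^ 28) ^ n :=
          mul_le_of_le_one_right (by positivity) (pow_le_one₀ hq0 hq1.le)
      _ ≤ h ^ 49 * (h ^ 28) ^ n := by gcongr
  rw [theta_one_eq hq0 hq1]
  have hρ1 : h ^ 28 < 1 := pow_lt_one₀ hh0 hh1 (by norm_num)
  have ht := tsum_le_sum_add_div hB (fun n => pow_nonneg hq0 _) 3 (K := h ^ 49) (ρ := h ^ 28)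
    (pow_nonneg hh0 _) hρ1 (fun n => by
      rw [show (2 * (n + 3) + 1) = 2 * n + 7 by ring]; exact tail n)
  have ht' := tsum_le_sum_add_div hB' (fun n => pow_nonneg hq0 _) 2 (K := h ^ 49) (ρ := h ^ 28)
    (pow_nonneg hh0 _) hρ1 (fun n => by
      rw [show (2 * (n + 2) + 3) = 2 * n + 7 by ring]; exact tail n)
  simp only [Finset.sum_range_succ, Finset.sum_range_zero] at ht ht'
  norm_num at ht ht'
  have e1 : q ≤ h := hqh
  have e2 : q ^ 9 ≤ h ^ 9 := pow_le_pow_left₀ hq0 hqh 9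
  have e3 : q ^ 25 ≤ h ^ 25 := pow_le_pow_left₀ hq0 hqh 25
  linarith

/-! ## Three-dimensional sums: product formula and parity cosets of `2ℤ³` -/

/-- `∑_{w ∈ ℤ³} ∏ᵢ Fᵢ(wᵢ) = ∏ᵢ ∑_{n ∈ ℤ} Fᵢ(n)` for nonnegative summable `F₀, F₁, F₂`
(Fubini for absolutely convergent triple series, via `ℤ³ ≃ ℤ × ℤ × ℤ`). [folklore] -/
theorem summable_and_tsum_prod_three {F : Fin 3 → ℤ → ℝ} (h0 : ∀ i n, 0 ≤ F i n)
    (hs : ∀ i, Summable (F i)) :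
    Summable (fun w : Fin 3 → ℤ => ∏ i, F i (w i)) ∧
      ∑' w : Fin 3 → ℤ, ∏ i, F i (w i) = ∏ i, ∑' n, F i n := by
  have hn : ∀ i, Summable fun n => ‖F i n‖ := fun i =>
    (hs i).congr fun n => by rw [Real.norm_of_nonneg (h0 i n)]
  have h12s : Summable fun p : ℤ × ℤ => F 1 p.1 * F 2 p.2 :=
    summable_mul_of_summable_norm (hn 1) (hn 2)
  have h12n : Summable fun p : ℤ × ℤ => ‖F 1 p.1 * F 2 p.2‖ :=
    h12s.congr fun p => by rw [Real.norm_of_nonneg (mul_nonneg (h0 1 _) (h0 2 _))]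
  have h012s : Summable fun p : ℤ × (ℤ × ℤ) => F 0 p.1 * (F 1 p.2.1 * F 2 p.2.2) :=
    summable_mul_of_summable_norm (g := fun p : ℤ × ℤ => F 1 p.1 * F 2 p.2) (hn 0) h12n
  let e : (Fin 3 → ℤ) ≃ ℤ × (ℤ × ℤ) :=
    { toFun := fun w => (w 0, (w 1, w 2))
      invFun := fun p => ![p.1, p.2.1, p.2.2]
      left_inv := fun w => by funext i; fin_cases i <;> rfl
      right_inv := fun _ => rfl }
  have key : ∀ w : Fin 3 → ℤ, ∏ i, F i (w i) =
      F 0 (e w).1 * (F 1 (e w).2.1 * F 2 (e w).2.2) := fun w => by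
    simp [Fin.prod_univ_three, e, mul_assoc]
  refine ⟨((e.summable_iff
    (f := fun p : ℤ × (ℤ × ℤ) => F 0 p.1 * (F 1 p.2.1 * F 2 p.2.2))).2 h012s).congr
      fun w => (key w).symm, ?_⟩
  rw [tsum_congr key, e.tsum_eq (fun p : ℤ × (ℤ × ℤ) => F 0 p.1 * (F 1 p.2.1 * F 2 p.2.2)),
    ← tsum_mul_tsum_of_summable_norm (hn 0) h12n, ← tsum_mul_tsum_of_summable_norm (hn 1) (hn 2),
    Fin.prod_univ_three, mul_assoc]

/-- `∑_{v ∈ ℤ³} q^{‖v‖²}` (written `∏ᵢ q^{vᵢ²}`) converges for `0 ≤ q < 1`. [folklore] -/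
theorem summable_cubicTerm (hq0 : 0 ≤ q) (hq1 : q < 1) :
    Summable fun v : Fin 3 → ℤ => ∏ i, q ^ ((v i).natAbs ^ 2) :=
  (summable_and_tsum_prod_three (F := fun _ n => q ^ (n.natAbs ^ 2)) (fun _ _ => pow_nonneg hq0 _)
    (fun _ => summable_pow_natAbs_sq hq0 hq1)).1

/-- `q^{‖0‖²} = 1`. [folklore] -/
theorem cubicTerm_zero (q : ℝ) : (∏ i, q ^ (((0 : Fin 3 → ℤ) i).natAbs ^ 2)) = 1 := by simp

/-- Removing the origin from a lattice sum: `∑_{D ∖ 0} f = ∑_D f - f(0)` when `0 ∈ D`.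
[folklore] -/
theorem tsum_indicator_sdiff_zero {D : Set (Fin 3 → ℤ)} (hD : (0 : Fin 3 → ℤ) ∈ D)
    {f : (Fin 3 → ℤ) → ℝ} (hf : Summable f) :
    ∑' v, (D \ {0}).indicator f v = ∑' v, D.indicator f v - f 0 := by
  rw [Set.indicator_sdiff (Set.singleton_subset_iff.2 hD) f]
  simp only [Pi.sub_apply]
  rw [(hf.indicator _).tsum_sub (hf.indicator _), ← _root_.tsum_subtype ({0} : Set (Fin 3 → ℤ)) f,
    tsum_singleton]

/-- The parity-coset map `w ↦ 2w + c` of `ℤ³` is injective. [folklore] -/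
theorem parityCoset_injective (c : Fin 3 → ℤ) :
    Function.Injective fun w : Fin 3 → ℤ => fun i => 2 * w i + c i := by
  intro v w hvw
  funext i
  have := congrFun hvw i
  simp only at this
  omega

/-- `v ∈ 2ℤ³ + c` iff `vᵢ ≡ cᵢ (mod 2)` coordinatewise, for a pattern `c ∈ {0,1}³`. [folklore] -/
theorem mem_range_parityCoset_iff {c : Fin 3 → ℤ} (hc : ∀ i, c i = 0 ∨ c i = 1)
    (v : Fin 3 → ℤ) :
    v ∈ Set.range (fun w : Fin 3 → ℤ => fun i => 2 * w i + c i) ↔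
      (v 0 % 2 = c 0 ∧ v 1 % 2 = c 1 ∧ v 2 % 2 = c 2) := by
  constructor
  · rintro ⟨w, rfl⟩
    have h0 := hc 0; have h1 := hc 1; have h2 := hc 2
    simp only; omega
  · rintro ⟨h0, h1, h2⟩
    refine ⟨fun i => (v i - c i) / 2, ?_⟩
    funext i
    fin_cases i <;> simp <;> omega

/-- **Coset factorisation**: `∑_{v ∈ 2ℤ³ + c} q^{‖v‖²} = ∏ᵢ θ_{cᵢ}(q)`,
`θ_c(q) = ∑_{n ∈ ℤ} q^{(2n+c)²}`. [folklore] -/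
theorem tsum_indicator_range_parityCoset (hq0 : 0 ≤ q) (hq1 : q < 1) (c : Fin 3 → ℤ) :
    ∑' v, (Set.range (fun w : Fin 3 → ℤ => fun i => 2 * w i + c i)).indicator
        (fun v => ∏ i, q ^ ((v i).natAbs ^ 2)) v =
      ∏ i, ∑' n : ℤ, q ^ ((2 * n + c i).natAbs ^ 2) := by
  rw [← _root_.tsum_subtype,
    tsum_range (fun v : Fin 3 → ℤ => ∏ i, q ^ ((v i).natAbs ^ 2)) (parityCoset_injective c)]
  exact (summable_and_tsum_prod_three (F := fun i n => q ^ ((2 * n + c i).natAbs ^ 2))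
    (fun _ _ => pow_nonneg hq0 _) (fun i => summable_theta_term hq0 hq1 (c i))).2

/-- `bcc = {v : v₁ ≡ v₂ ≡ v₃ (2)} = 2ℤ³ ⊔ (2ℤ³ + (1,1,1))`, as an identity of indicators.
[cite: ConwaySloane1999, Ch. 4 §6.7 (before eq. (83))] -/
theorem indicator_bccInt (f : (Fin 3 → ℤ) → ℝ) (v : Fin 3 → ℤ) :
    {v : Fin 3 → ℤ | v 0 ≡ v 1 [ZMOD 2] ∧ v 1 ≡ v 2 [ZMOD 2]}.indicator f v =
      (Set.range (fun w : Fin 3 → ℤ => fun i => 2 * w i + (0 : Fin 3 → ℤ) i)).indicator f v +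
      (Set.range (fun w : Fin 3 → ℤ => fun i => 2 * w i + (1 : Fin 3 → ℤ) i)).indicator f v := by
  have e0 := mem_range_parityCoset_iff (c := 0) (by simp) v
  have e1 := mem_range_parityCoset_iff (c := 1) (by simp) v
  simp only [Pi.zero_apply, add_zero, Pi.one_apply] at e0 e1
  have eB : v ∈ {v : Fin 3 → ℤ | v 0 ≡ v 1 [ZMOD 2] ∧ v 1 ≡ v 2 [ZMOD 2]} ↔
      (v 0 % 2 = v 1 % 2 ∧ v 1 % 2 = v 2 % 2) := by simp [Int.ModEq]
  rcases Int.emod_two_eq (v 0) with h0 | h0 <;> rcases Int.emod_two_eq (v 1) with h1 | h1 <;>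
    rcases Int.emod_two_eq (v 2) with h2 | h2 <;>
      simp [e0, e1, eB, h0, h1, h2]

/-- `D₃ = {v : v₁ + v₂ + v₃ even} = 2ℤ³ ⊔ (2ℤ³ + 110) ⊔ (2ℤ³ + 101) ⊔ (2ℤ³ + 011)`, as an
identity of indicators. [cite: ConwaySloane1999, Ch. 4 §6.3 and §7.1 (definition of `D₃`)] -/
theorem indicator_fccInt (f : (Fin 3 → ℤ) → ℝ) (v : Fin 3 → ℤ) :
    {v : Fin 3 → ℤ | Even (v 0 + v 1 + v 2)}.indicator f v =
      (Set.range (fun w : Fin 3 → ℤ => fun i => 2 * w i + (0 : Fin 3 → ℤ) i)).indicator f v +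
      (Set.range (fun w : Fin 3 → ℤ => fun i => 2 * w i + ![1, 1, 0] i)).indicator f v +
      (Set.range (fun w : Fin 3 → ℤ => fun i => 2 * w i + ![1, 0, 1] i)).indicator f v +
      (Set.range (fun w : Fin 3 → ℤ => fun i => 2 * w i + ![0, 1, 1] i)).indicator f v := by
  have e0 := mem_range_parityCoset_iff (c := 0) (by simp) v
  have e1 := mem_range_parityCoset_iff (c := ![1, 1, 0]) (fun i => by fin_cases i <;> simp) v
  have e2 := mem_range_parityCoset_iff (c := ![1, 0, 1]) (fun i => by fin_cases i <;> simp) v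
  have e3 := mem_range_parityCoset_iff (c := ![0, 1, 1]) (fun i => by fin_cases i <;> simp) v
  simp only [Pi.zero_apply, add_zero, Matrix.cons_val_zero, Matrix.cons_val_one,
    Matrix.cons_val_two, Matrix.head_cons, Matrix.tail_cons] at e0 e1 e2 e3
  have eD : v ∈ {v : Fin 3 → ℤ | Even (v 0 + v 1 + v 2)} ↔
      (v 0 % 2 + v 1 % 2 + v 2 % 2) % 2 = 0 := by
    simp only [Set.mem_setOf_eq, Int.even_iff]; omega
  rcases Int.emod_two_eq (v 0) with h0 | h0 <;> rcases Int.emod_two_eq (v 1) with h1 | h1 <;>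
    rcases Int.emod_two_eq (v 2) with h2 | h2 <;>
      simp [e0, e1, e2, e3, eD, h0, h1, h2]

/-- **Conway–Sloane Ch. 4 (84)**: `Θ_bcc = θ₂(4z)³ + θ₃(4z)³`, origin removed:
`∑_{v ∈ bcc ∖ 0} q^{‖v‖²} = θ₀(q)³ + θ₁(q)³ - 1` with
`bcc = {v ∈ ℤ³ : v₁ ≡ v₂ ≡ v₃ (2)}`, `θ_c(q) = ∑_{n ∈ ℤ} q^{(2n+c)²}`, `0 ≤ q < 1`.
[cite: ConwaySloane1999, Ch. 4 §6.7 eq. (84)] -/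
theorem tsum_indicator_bccInt (hq0 : 0 ≤ q) (hq1 : q < 1) :
    ∑' v, ({v : Fin 3 → ℤ | v 0 ≡ v 1 [ZMOD 2] ∧ v 1 ≡ v 2 [ZMOD 2]} \ {0}).indicator
        (fun v => ∏ i, q ^ ((v i).natAbs ^ 2)) v =
      (∑' n : ℤ, q ^ ((2 * n + 0).natAbs ^ 2)) ^ 3 +
        (∑' n : ℤ, q ^ ((2 * n + 1).natAbs ^ 2)) ^ 3 - 1 := by
  have hD : (0 : Fin 3 → ℤ) ∈ {v : Fin 3 → ℤ | v 0 ≡ v 1 [ZMOD 2] ∧ v 1 ≡ v 2 [ZMOD 2]} := by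
    simp
  have hs := fun A : Set (Fin 3 → ℤ) => (summable_cubicTerm hq0 hq1).indicator A
  rw [tsum_indicator_sdiff_zero hD (summable_cubicTerm hq0 hq1), cubicTerm_zero,
    tsum_congr (indicator_bccInt _), (hs _).tsum_add (hs _),
    tsum_indicator_range_parityCoset hq0 hq1, tsum_indicator_range_parityCoset hq0 hq1]
  simp only [Fin.prod_univ_three, Pi.zero_apply, Pi.one_apply]
  ring

/-- **Conway–Sloane Ch. 4 (66)**: `Θ_fcc = θ₃(4z)³ + 3θ₃(4z)θ₂(4z)²`, origin removed:
`∑_{v ∈ D₃ ∖ 0} q^{‖v‖²} = θ₀(q)³ + 3 θ₀(q) θ₁(q)² - 1` with `D₃ = {v ∈ ℤ³ : v₁+v₂+v₃ even}`,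
`θ_c(q) = ∑_{n ∈ ℤ} q^{(2n+c)²}`, `0 ≤ q < 1`. [cite: ConwaySloane1999, Ch. 4 §6.3 eq. (66)] -/
theorem tsum_indicator_fccInt (hq0 : 0 ≤ q) (hq1 : q < 1) :
    ∑' v, ({v : Fin 3 → ℤ | Even (v 0 + v 1 + v 2)} \ {0}).indicator
        (fun v => ∏ i, q ^ ((v i).natAbs ^ 2)) v =
      (∑' n : ℤ, q ^ ((2 * n + 0).natAbs ^ 2)) ^ 3 +
        3 * (∑' n : ℤ, q ^ ((2 * n + 0).natAbs ^ 2)) *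
          (∑' n : ℤ, q ^ ((2 * n + 1).natAbs ^ 2)) ^ 2 - 1 := by
  have hD : (0 : Fin 3 → ℤ) ∈ {v : Fin 3 → ℤ | Even (v 0 + v 1 + v 2)} := by simp
  have hs := fun A : Set (Fin 3 → ℤ) => (summable_cubicTerm hq0 hq1).indicator A
  rw [tsum_indicator_sdiff_zero hD (summable_cubicTerm hq0 hq1), cubicTerm_zero,
    tsum_congr (indicator_fccInt _),
    (((hs _).add (hs _)).add (hs _)).tsum_add (hs _), ((hs _).add (hs _)).tsum_add (hs _),
    (hs _).tsum_add (hs _),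
    tsum_indicator_range_parityCoset hq0 hq1, tsum_indicator_range_parityCoset hq0 hq1,
    tsum_indicator_range_parityCoset hq0 hq1, tsum_indicator_range_parityCoset hq0 hq1]
  simp only [Fin.prod_univ_three, Pi.zero_apply, Matrix.cons_val_zero, Matrix.cons_val_one,
    Matrix.cons_val_two, Matrix.head_cons, Matrix.tail_cons]
  ring

end Literature.Algebra.EuclideanLattices

end
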